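import Literature.AnabelianGeometry.EtaleTheta.SettingModelChiTheta
import Literature.AnabelianGeometry.EtaleTheta.SettingModelChiLevelKernels
import Literature.AnabelianGeometry.EtaleTheta.SettingModelCuspAxis
import Literature.AnabelianGeometry.EtaleTheta.SettingModelThetaCentreZHat
import Literature.AnabelianGeometry.EtaleTheta.SettingModelChiKummerData
import Literature.AnabelianGeometry.EtaleTheta.SettingModelChiDoubleUnderline
import Literature.AnabelianGeometry.EtaleTheta.SettingModelGfpRigidity
import Literature.AnabelianGeometry.EtaleTheta.ThetaSettingOriginClauses
import Literature.AnabelianGeometry.EtaleTheta.Discharge.Sec1Thm16GKNTate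
import HarnessLib

/-!
# The Tate-module clause TM₂ (`tate2`) HOLDS at the χ-twisted model; `G_{K₂} = Ker(G_K ↷ (Δ^tp_X)^ell/2)` there

abc-iut cell, layer L2, R78 cluster (χ-TWISTED root model of [EtTh] §1, integrator abc-iut-L6-d6), companion of
F9 `SettingModelChiOriginProfile` (seat abc-iut-w5-d051 gen 3, author of the clause text TM / TM₂ of
abc-iut-L2-t6's `ThetaSetting.IsThm16Origin.tate2` / `IsTateOrigin.tate`). Mochizuki, *The étale theta function …*,
Publ. RIMS **45** (2009) [EtTh], §1 p. 13 [cite: MochizukiEtTh2009, §1 p.13]: «`(Δ^tp_Y)^ell ≅ Ẑ(1)`»,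
«`G_{K_N}` acts trivially on `(Δ^tp_X)^ell/N·(Δ^tp_Y)^ell`», `K_2 = K(ζ_2, q_X^{1/2})`.

At abc-iut-L2-t1's χ-model `ThetaSetting.modelχ p` (F5b; `Π^tp_X = (F̂₂ ×_Ẑ ℤ) ⋊_χ G_{ℚ_p}`, `q_X = p²`) the
ell-quotient of the geometric part is read through two Ẑ-COORDINATES: `ê ∘ pr₁` (the `a`-exponent, abc-iut-L2-t1)
and `ê_b ∘ pr₁` (the `b`-exponent, abc-iut-w5-d029's `eHatB`): by abc-iut-L6-d6's `mem_ellKerχ_iff` and level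
determination (`ZHatLevel.ext_of_level`), `inl q ∈ Ker(Π^tp_X ↠ (Π^tp_X)^ell) ↔ ê(pr₁ q) = 1 ∧ ê_b(pr₁ q) = 1`
(`inl_mem_ellKerχ_iff`). With abc-iut-w5-d171's `ê_b ∘ θ_φ = φ ∘ ê_b` (`eHatB_twist`, `SettingModelChiKummerData`), the triviality of every level-`2` cyclotomic
character (`level_two_aut`: units of `ℤ/2`), and «`Ker(Ẑ → ℤ/2) = Ẑ²`» (`ZHatLevel.level_eq_one_iff_exists_pow`)
this gives the SQUARE CRITERION `toEll_inl_mem_ellPowersY_two`: `(inl q)^ell ∈ 2·(Δ^tp_Y)^ell` as soon as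
`ê(pr₁ q) = 1` and `ê_b(pr₁ q)` dies in `ℤ/2`. Hence

* **`modelχ_tate2`** — the clause TM₂ HOLDS at the χ-model with `y₁ = inl(b)`, `z = inl(a)`, `ζ = −1`, `r = p`:
  (a) `(Δ^tp_Y)^ell/2` is cyclic on `ȳ₁` (every `y` is `y₁^{ê_b(y) mod 2}` times a square), (a′) `ȳ₁^k` is a
  square iff `2 ∣ k` (the level-`2` character `ê_b mod 2` descends to `(Π^tp_X)^ell`, kills the squares and sees
  `ȳ₁`), (b) the Tate twist (conjugation multiplies `ê_b` by `χ(σ)`, invisible mod `2`; `k` is odd), (c) the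
  Kummer class of `q_X = p²` (`m` is even; the `a`-axis is untwisted so `[g, z]` has `ê = ê_b = 1`);
* **`modelχ_gknIsKernelOfAction_two`** — «`G_{K_2} = Ker(G_K ↷ (Δ^tp_X)^ell/2·(Δ^tp_Y)^ell)`» (abc-iut-L6-d5's
  `Thm16Sub.GKNIsKernelOfAction (modelχ p) 2`) by this seat's `gknIsKernelOfAction_of_tate` (p420414).

With F9 this completes the stage-1 profile of `IsThm16Origin` at the χ-model: R1 ✓ R2 ✓ (vacuous) cusp ✗ R3 (open)
TM₂ ✓ — and `IsTateOrigin` ✗ (F9, level `3`). PROOF-ONLY (no definition, no named fact). Semi-synthetic model =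
consistency evidence only; nothing of [EtTh] is asserted; no side is taken on [IUTchIII] Cor. 3.12; typed ≠ proved.
-/

noncomputable section

namespace Literature.AnabelianGeometry.EtaleTheta.SettingModel

open Literature.AnabelianGeometry.SemiGraphs Thm16Sub Function Topology
/-! ### 1. Ẑ-level arithmetic -/

/-- `Ẑ` is commutative (componentwise in the finite quotients `ℤ/N`). [folklore] -/
private theorem zh_mul_comm (a b : ZH) : a * b = b * a := by
  apply Subtype.ext
  funext N
  change a.val N * b.val N = b.val N * a.val N
  have key : ∀ u v : Multiplicative ℤ ⧸ N.toSubgroup, u * v = v * u := fun u v => _root_.mul_comm u v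
  exact key (a.val N) (b.val N)

/-- In `ℤ/2` every product `a·b = 1` forces `a = 1`. [folklore] -/
private theorem zmod_two_eq_one_of_mul_eq_one {a b : ZMod 2} (h : a * b = 1) : a = 1 := by
  revert a b h; decide

/-- **Every automorphism of `Ẑ` is invisible at level `2`** (`(ℤ/2)^× = 1`): `level 2 (φ t) = level 2 t`.
[cite: RibesZalesskii2010, Thm 2.7.1] -/
theorem level_two_aut (φ : MulAut ZH) (t : ZH) : ZHatLevel.level 2 (φ t) = ZHatLevel.level 2 t := by
  have h := ZHatLevel.toAdd_level_aut 2 φ t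
  have hχ : ZHatLevel.levelChar 2 φ = 1 := by
    have h1 := ZHatLevel.levelChar_mul_levelChar_inv 2 φ
    exact zmod_two_eq_one_of_mul_eq_one h1
  rw [hχ, one_mul] at h
  exact Multiplicative.toAdd.injective h

/-- `level 2 (ι 1) = 1 ∈ ℤ/2`. [cite: RibesZalesskii2010, Thm 2.7.1] -/
theorem level_two_iotaZ_one :
    ZHatLevel.level 2 (iotaZ (Multiplicative.ofAdd 1)) = Multiplicative.ofAdd 1 := by
  rw [iotaZ_one_eq, ZHatLevel.level_eta, Int.cast_one]

/-- An element of `Ẑ` all of whose levels vanish is trivial. [cite: RibesZalesskii2010, Thm 2.7.1] -/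
theorem zh_eq_one_of_forall_level {s : ZH} (h : ∀ N : ℕ+, ZHatLevel.level N s = 1) : s = 1 :=
  ZHatLevel.ext_of_level fun N => by rw [h N, map_one]

/-! ### 2. Arithmetic in `Multiplicative (ℤ/2)` -/

/-- In `Multiplicative (ℤ/2)` every square is trivial. [folklore] -/
private theorem mulZMod_two_sq (u : Multiplicative (ZMod 2)) : u ^ 2 = 1 := by
  rw [← ofAdd_toAdd u, ← ofAdd_nsmul]
  have : (2 : ℕ) • Multiplicative.toAdd u = 0 := by
    rw [nsmul_eq_mul, Nat.cast_ofNat]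
    have h2 : (2 : ZMod 2) = 0 := by decide
    rw [h2, zero_mul]
  rw [this, ofAdd_zero]

/-- In `Multiplicative (ℤ/2)` every even power is trivial. [folklore] -/
private theorem mulZMod_two_pow_even (u : Multiplicative (ZMod 2)) {k : ℕ} (hk : Even k) : u ^ k = 1 := by
  obtain ⟨j, rfl⟩ := hk
  rw [← two_mul, pow_mul, mulZMod_two_sq, one_pow]

/-- In `Multiplicative (ℤ/2)` every element is its own inverse. [folklore] -/
private theorem mulZMod_two_inv (u : Multiplicative (ZMod 2)) : u⁻¹ = u :=
  inv_eq_of_mul_eq_one_right (by rw [← sq]; exact mulZMod_two_sq u)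

section Model

variable (p : ℕ) [Fact p.Prime]

/-! ### 3. The ell-quotient of the χ-model in the coordinates `(ê, ê_b)` -/

/-- **`inl q ∈ Ker(Π^tp_X ↠ (Π^tp_X)^ell)` iff `ê(pr₁ q) = 1` and `ê_b(pr₁ q) = 1`** (abc-iut-L6-d6's
`mem_ellKerχ_iff` read through the level characters of the two exponent sums). [cite: MochizukiEtTh2009, §1 p.12] -/
theorem inl_mem_ellKerχ_iff (q : Gfp) :
    (SemidirectProduct.inl q : PiTpχ p) ∈ CurveTheta.ellKer (curveχ p) ↔
      eHat (gfpFst q) = 1 ∧ eHatB (gfpFst q) = 1 := by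
  rw [mem_ellKerχ_iff, SemidirectProduct.left_inl, SemidirectProduct.right_inl]
  constructor
  · rintro ⟨h, -⟩
    refine ⟨zh_eq_one_of_forall_level fun N => ?_, zh_eq_one_of_forall_level fun N => ?_⟩
    · rw [← modN_eq_level, ← hHat_x_eq_modN_eHat, (h N).1, ofAdd_zero]
    · rw [← modN_eq_level, ← hHat_y_eq_modN_eHatB, (h N).2, ofAdd_zero]
  · rintro ⟨hx, hy⟩
    refine ⟨fun N => ⟨?_, ?_⟩, rfl⟩
    · exact hHat_x_eq_zero_of_eHat_eq_one N hx
    · have h := hHat_y_eq_modN_eHatB N (gfpFst q)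
      rw [hy, map_one] at h
      exact ofAdd_eq_one.mp h

/-- The ell-quotient map of the χ-model is the quotient by `CurveTheta.ellKer (curveχ p)`.
[cite: MochizukiEtTh2009, §1 p.12] -/
theorem toEll_modelχ_apply (g : PiTpχ p) :
    toEll (ThetaSetting.modelχ p) g = QuotientGroup.mk' (CurveTheta.ellKer (curveχ p)) g := by
  change ((CurveTheta.thetaToEll (curveχ p)).comp (CurveTheta.toTheta (curveχ p))) g = _
  rw [CurveTheta.thetaToEll_comp]

/-- Equality in `(Π^tp_X)^ell` of the χ-model. [cite: MochizukiEtTh2009, §1 p.12] -/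
theorem toEll_modelχ_eq_iff (g h : PiTpχ p) :
    toEll (ThetaSetting.modelχ p) g = toEll (ThetaSetting.modelχ p) h ↔
      g⁻¹ * h ∈ CurveTheta.ellKer (curveχ p) := by
  rw [toEll_modelχ_apply, toEll_modelχ_apply, QuotientGroup.mk'_apply, QuotientGroup.mk'_apply,
    QuotientGroup.eq]

/-- `inl q ∈ Δ^tp_Y` iff `pr₂ q = 0`. [cite: MochizukiEtTh2009, §1 p.12] -/
theorem inl_mem_dtpY_modelχ_iff (q : Gfp) :
    (SemidirectProduct.inl q : PiTpχ p) ∈ (ThetaSetting.modelχ p).DtpY ↔ gfpSnd q = 1 := by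
  change (SemidirectProduct.inl q : PiTpχ p) ∈ ((chiTwistData p).toZ).ker ⊓ (curveχ p).DeltaTemp ↔ _
  rw [Subgroup.mem_inf, MonoidHom.mem_ker, GfpTwistData.toZ_apply, SemidirectProduct.left_inl,
    mem_deltaTempχ_iff, SemidirectProduct.right_inl]
  exact ⟨fun h => h.1, fun h => ⟨h, rfl⟩⟩

/-- Elements of `Δ^tp_Y` of the χ-model: `right = 1`, `pr₂ left = 0`, hence `ê(pr₁ left) = 1`.
[cite: MochizukiEtTh2009, §1 p.12] -/
theorem right_eq_one_and_eHat_eq_one_of_mem_dtpY {y : PiTpχ p} (hy : y ∈ (ThetaSetting.modelχ p).DtpY) :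
    y.right = 1 ∧ gfpSnd y.left = 1 ∧ eHat (gfpFst y.left) = 1 := by
  obtain ⟨h1, h2⟩ := Subgroup.mem_inf.mp hy
  have hr : y.right = 1 := (mem_deltaTempχ_iff p y).mp h2
  have hs : gfpSnd y.left = 1 := by
    change y ∈ ((chiTwistData p).toZ).ker at h1
    rwa [MonoidHom.mem_ker, GfpTwistData.toZ_apply] at h1
  exact ⟨hr, hs, eHat_gfpFst_eq_one hs⟩

/-- `inl(b^t) ∈ Δ^tp_Y`. [cite: MochizukiEtTh2009, §1 p.12] -/
theorem inl_bPowGfp_mem_dtpY (t : ZH) :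
    (SemidirectProduct.inl (bPowGfp t) : PiTpχ p) ∈ (ThetaSetting.modelχ p).DtpY :=
  (inl_mem_dtpY_modelχ_iff p _).mpr (gfpSnd_bPowGfp t)

/-- **SQUARE CRITERION.** If `ê(pr₁ q) = 1` and `ê_b(pr₁ q)` dies in `ℤ/2`, then `(inl q)^ell ∈ 2·(Δ^tp_Y)^ell`:
`ê_b(pr₁ q) = t²` in `Ẑ` («`Ker(Ẑ → ℤ/2) = Ẑ²`»), and `(inl q)^ell = ((inl b^t)^ell)²` since both have the same
coordinates `(ê, ê_b) = (1, t²)`. [cite: MochizukiEtTh2009, §1 p.13] -/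
theorem toEll_inl_mem_ellPowersY_two {q : Gfp} (hx : eHat (gfpFst q) = 1)
    (hy : ZHatLevel.level 2 (eHatB (gfpFst q)) = 1) :
    toEll (ThetaSetting.modelχ p) (SemidirectProduct.inl q) ∈ ellPowersY (ThetaSetting.modelχ p) 2 := by
  obtain ⟨t, ht⟩ := (ZHatLevel.level_eq_one_iff_exists_pow 2 _).mp hy
  have h2 : ((2 : ℕ+) : ℕ) = 2 := rfl
  rw [h2] at ht
  set w : PiTpχ p := SemidirectProduct.inl (bPowGfp t) with hw
  have hwY : w ∈ (ThetaSetting.modelχ p).DtpY := inl_bPowGfp_mem_dtpY p t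
  have heq : toEll (ThetaSetting.modelχ p) (SemidirectProduct.inl q) =
      toEll (ThetaSetting.modelχ p) w ^ 2 := by
    rw [← map_pow, eq_comm, toEll_modelχ_eq_iff, hw, ← map_pow, ← map_inv, ← map_mul, inl_mem_ellKerχ_iff,
      map_mul, map_inv, map_pow, gfpFst_bPowGfp, map_mul, map_mul, map_inv, map_inv, map_pow, map_pow,
      eHat_bPow, eHatB_bPow, hx, ht, one_pow, inv_one, one_mul, inv_mul_cancel]
    exact ⟨rfl, rfl⟩
  rw [heq]
  refine Subgroup.subset_closure ⟨toEll (ThetaSetting.modelχ p) w, ⟨w, hwY, rfl⟩, ?_⟩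
  simp only [h2]

/-! ### 4. The clause TM₂ at the χ-model -/

/-- The graph element `(η a, 1) ∈ Γ` (a lift of `1 ∈ Z`). [cite: MochizukiEtTh2009, §1 p.12] -/
private theorem eta_a_mem_Gfp' :
    ((eta (FreeGroup.of 0), Multiplicative.ofAdd (1 : ℤ)) : F₂hatT × Multiplicative ℤ) ∈ Gfp := by
  have h := eta_mk_mem_Gfp (FreeGroup.of 0)
  rwa [expA_apply, heisHom_of_zero] at h

/-- The `a`-axis is untwisted: `θ_{χ(σ)}` fixes `(η a, 1)`. [cite: MochizukiEtTh2009, §1 p.12] -/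
private theorem actχ_eta_a' (σ : GQp p) :
    actχ p σ ⟨(eta (FreeGroup.of 0), Multiplicative.ofAdd (1 : ℤ)), eta_a_mem_Gfp'⟩ =
      ⟨(eta (FreeGroup.of 0), Multiplicative.ofAdd (1 : ℤ)), eta_a_mem_Gfp'⟩ := by
  apply Subtype.ext
  rw [actχ_apply, coe_twistGfp]
  exact Prod.ext (twist_eta_of_zero _) rfl

/-- `−1 ≠ 1` in `ℚ̄_p`. [folklore] -/
private theorem neg_one_ne_one'' : (-1 : PadicAlgCl p) ≠ 1 := by
  intro h
  have h2 : (2 : PadicAlgCl p) = 0 := by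
    calc (2 : PadicAlgCl p) = 1 - (-1) := by norm_num
      _ = 0 := by rw [h, sub_self]
  exact two_ne_zero h2

/-- `(−1)^k = −1` forces `k` odd. [folklore] -/
private theorem odd_of_neg_one_pow_eq' {k : ℕ} (h : (-1 : PadicAlgCl p) ^ k = -1) : Odd k := by
  rcases Nat.even_or_odd k with hk | hk
  · rw [hk.neg_one_pow] at h
    exact absurd h.symm (neg_one_ne_one'' p)
  · exact hk

/-- `(−1)^m = 1` forces `m` even. [folklore] -/
private theorem even_of_neg_one_pow_eq_one' {m : ℕ} (h : (-1 : PadicAlgCl p) ^ m = 1) : Even m := by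
  rcases Nat.even_or_odd m with hm | hm
  · exact hm
  · rw [hm.neg_one_pow] at h
    exact absurd h (neg_one_ne_one'' p)

/-- Conjugation in `Π^tp_X = Γ ⋊_χ G_{ℚ_p}` of a `Δ`-element: `g · inl q · g⁻¹ = inl (g.left · θ_{χ(g.right)} q · g.left⁻¹)`.
[cite: MochizukiEtTh2009, §1 p.12] -/
theorem conj_inl_eq (g : PiTpχ p) (q : Gfp) :
    g * SemidirectProduct.inl q * g⁻¹ = SemidirectProduct.inl (g.left * actχ p g.right q * g.left⁻¹) := by
  have h1 : (SemidirectProduct.inr g.right : PiTpχ p) * SemidirectProduct.inl q * (SemidirectProduct.inr g.right)⁻¹ =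
      SemidirectProduct.inl (actχ p g.right q) := by
    rw [← map_inv, ← SemidirectProduct.inl_aut]
  calc g * SemidirectProduct.inl q * g⁻¹
      = (SemidirectProduct.inl g.left * SemidirectProduct.inr g.right) * SemidirectProduct.inl q *
          (SemidirectProduct.inl g.left * SemidirectProduct.inr g.right)⁻¹ := by
        rw [SemidirectProduct.inl_left_mul_inr_right]
    _ = SemidirectProduct.inl g.left *
          ((SemidirectProduct.inr g.right : PiTpχ p) * SemidirectProduct.inl q * (SemidirectProduct.inr g.right)⁻¹) *
          (SemidirectProduct.inl g.left)⁻¹ := by group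
    _ = SemidirectProduct.inl (g.left * actχ p g.right q * g.left⁻¹) := by
        rw [h1, ← map_inv, ← map_mul, ← map_mul]

/-- **The clause TM₂ (`tate2`) HOLDS at the χ-twisted model** with `y₁ = inl(b)`, `z = inl(a)`, `ζ = −1`, `r = p`.
[cite: MochizukiEtTh2009, §1 p.13] -/
theorem modelχ_tate2 :
    ∃ (y₁ z : (ThetaSetting.modelχ p).PiTemp) (ζ r : PadicAlgCl p),
      y₁ ∈ (ThetaSetting.modelχ p).DtpY ∧ z ∈ (ThetaSetting.modelχ p).DeltaTemp ∧
      (ThetaSetting.modelχ p).toZ z = Multiplicative.ofAdd 1 ∧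
      IsPrimitiveRoot ζ ((2 : ℕ+) : ℕ) ∧ r ^ ((2 : ℕ+) : ℕ) = (ThetaSetting.modelχ p).qX ∧
      (∀ y : (ThetaSetting.modelχ p).PiTemp, y ∈ (ThetaSetting.modelχ p).DtpY → ∃ k : ℕ,
        toEll (ThetaSetting.modelχ p) y * (toEll (ThetaSetting.modelχ p) y₁ ^ k)⁻¹ ∈
          ellPowersY (ThetaSetting.modelχ p) 2) ∧
      (∀ k : ℕ, toEll (ThetaSetting.modelχ p) y₁ ^ k ∈ ellPowersY (ThetaSetting.modelχ p) 2 ↔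
        ((2 : ℕ+) : ℕ) ∣ k) ∧
      (∀ (g : (ThetaSetting.modelχ p).PiTemp) (k : ℕ), (ThetaSetting.modelχ p).aug g ζ = ζ ^ k →
        ∀ y : (ThetaSetting.modelχ p).PiTemp, y ∈ (ThetaSetting.modelχ p).DtpY →
          toEll (ThetaSetting.modelχ p) (g * y * g⁻¹) * (toEll (ThetaSetting.modelχ p) y ^ k)⁻¹ ∈
            ellPowersY (ThetaSetting.modelχ p) 2) ∧
      (∀ (g : (ThetaSetting.modelχ p).PiTemp) (m : ℕ), (ThetaSetting.modelχ p).aug g r = ζ ^ m * r →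
        toEll (ThetaSetting.modelχ p) (g * z * g⁻¹ * z⁻¹) * (toEll (ThetaSetting.modelχ p) y₁ ^ m)⁻¹ ∈
          ellPowersY (ThetaSetting.modelχ p) 2) := by
  set D := ThetaSetting.modelχ p with hD
  have h2 : ((2 : ℕ+) : ℕ) = 2 := rfl
  have hp0 : ((p : ℕ) : PadicAlgCl p) ≠ 0 := Nat.cast_ne_zero.mpr (Fact.out : p.Prime).ne_zero
  -- the data
  let bG : Gfp := bPowGfp (iotaZ (Multiplicative.ofAdd 1))
  let aG : Gfp := ⟨(eta (FreeGroup.of 0), Multiplicative.ofAdd (1 : ℤ)), eta_a_mem_Gfp'⟩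
  let y₁ : D.PiTemp := (SemidirectProduct.inl bG : PiTpχ p)
  let z : D.PiTemp := (SemidirectProduct.inl aG : PiTpχ p)
  have hbG_fst : gfpFst bG = eta (FreeGroup.of 1) := by rw [gfpFst_bPowGfp, bPow_iotaZ_one]
  have hbG_x : eHat (gfpFst bG) = 1 := by rw [gfpFst_bPowGfp, eHat_bPow]
  have hbG_y : eHatB (gfpFst bG) = iotaZ (Multiplicative.ofAdd 1) := by rw [gfpFst_bPowGfp, eHatB_bPow]
  have haG_x : eHat (gfpFst aG) = iotaZ (Multiplicative.ofAdd 1) := by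
    rw [gfpFst_apply]
    change eHat (eta (FreeGroup.of 0)) = _
    rw [eHat_eta, expA_apply, heisHom_of_zero]
  have haG_y : eHatB (gfpFst aG) = 1 := by
    rw [gfpFst_apply]
    exact eHatB_eta_of_zero
  -- the same two facts with `aG` unfolded (for goals produced by `actχ_eta_a'`)
  have haG_x' : eHat (gfpFst ⟨(eta (FreeGroup.of 0), Multiplicative.ofAdd (1 : ℤ)), eta_a_mem_Gfp'⟩) =
      iotaZ (Multiplicative.ofAdd 1) := haG_x
  have hy₁ : y₁ ∈ D.DtpY := inl_bPowGfp_mem_dtpY p _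
  have hz : z ∈ D.DeltaTemp := (mem_deltaTempχ_iff p _).mpr (SemidirectProduct.right_inl _)
  have hzZ : D.toZ z = Multiplicative.ofAdd 1 := by
    change (chiTwistData p).toZ _ = _
    rw [GfpTwistData.toZ_apply, SemidirectProduct.left_inl, gfpSnd_apply]
  -- the level-`2` character, read in `ℤ/2`
  let lev : ZH →* Multiplicative (ZMod 2) := ZHatLevel.level 2
  have hlev : ∀ t : ZH, lev t = ZHatLevel.level 2 t := fun _ => rfl
  have hlev_aut : ∀ (φ : MulAut ZH) (t : ZH), lev (φ t) = lev t := fun φ t => level_two_aut φ t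
  have hlev_bG : lev (eHatB (gfpFst bG)) = Multiplicative.ofAdd 1 := by
    rw [hbG_y]; exact level_two_iotaZ_one
  have hlev_one : lev (iotaZ (Multiplicative.ofAdd 1)) = Multiplicative.ofAdd 1 := level_two_iotaZ_one
  refine ⟨y₁, z, -1, ((p : ℕ) : PadicAlgCl p), hy₁, hz, hzZ, ?_, ?_, ?_, ?_, ?_, ?_⟩
  · rw [h2]; exact IsPrimitiveRoot.neg_one 0 (by decide)
  · rw [h2]; rfl
  · -- (a) generation: `y ≡ y₁^{ê_b(y) mod 2}` modulo squares
    intro y hy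
    obtain ⟨hyr, -, hyx⟩ := right_eq_one_and_eHat_eq_one_of_mem_dtpY p hy
    set v : ZMod 2 := Multiplicative.toAdd (lev (eHatB (gfpFst y.left))) with hv
    refine ⟨v.val, ?_⟩
    rw [← map_pow (toEll D), ← map_inv (toEll D), ← map_mul (toEll D), eq_inl_of_right_eq_one hyr]
    change toEll D (SemidirectProduct.inl y.left * ((SemidirectProduct.inl bG : PiTpχ p) ^ v.val)⁻¹) ∈ _
    rw [← map_pow (SemidirectProduct.inl : Gfp →* PiTpχ p), ← map_inv (SemidirectProduct.inl : Gfp →* PiTpχ p),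
      ← map_mul (SemidirectProduct.inl : Gfp →* PiTpχ p)]
    refine toEll_inl_mem_ellPowersY_two p ?_ ?_
    · simp only [map_mul, map_inv, map_pow, hyx, hbG_x, one_pow, inv_one, mul_one]
    · show lev (eHatB (gfpFst (y.left * (bG ^ v.val)⁻¹))) = 1
      simp only [map_mul, map_inv, map_pow]
      rw [hlev_bG, ← ofAdd_nsmul, nsmul_eq_mul, mul_one, ZMod.natCast_zmod_val, hv, ofAdd_toAdd,
        mul_inv_cancel]
  · -- (a′) `ȳ₁^k` is a square iff `2 ∣ k`
    intro k
    rw [h2]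
    constructor
    · intro hk
      -- the level-2 `b`-exponent as a homomorphism on `Π^tp_X`, descended to `(Π^tp_X)^ell`
      let Ψ₀ : PiTpχ p →* Multiplicative (ZMod 2) :=
        MonoidHom.mk' (fun g => lev (eHatB (gfpFst g.left))) fun g h => by
          show lev (eHatB (gfpFst (g * h).left)) = lev (eHatB (gfpFst g.left)) * lev (eHatB (gfpFst h.left))
          rw [SemidirectProduct.mul_left, map_mul, map_mul, map_mul, actχ_apply, gfpFst_twistGfp, eHatB_twist,
            hlev_aut]
      have hΨ₀ : ∀ g : PiTpχ p, Ψ₀ g = lev (eHatB (gfpFst g.left)) := fun _ => rfl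
      have hker : CurveTheta.ellKer (curveχ p) ≤ Ψ₀.ker := by
        intro g hg
        have hgr : g.right = 1 := right_eq_one_of_mem_ellKerχ p hg
        rw [eq_inl_of_right_eq_one hgr, inl_mem_ellKerχ_iff] at hg
        rw [MonoidHom.mem_ker, hΨ₀, hg.2, map_one]
      let Ψ : D.GtpEll →* Multiplicative (ZMod 2) := QuotientGroup.lift (CurveTheta.ellKer (curveχ p)) Ψ₀ hker
      have hΨ : ∀ g : PiTpχ p, Ψ (toEll D g) = Ψ₀ g := fun g => by
        change Ψ (toEll (ThetaSetting.modelχ p) g) = _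
        rw [toEll_modelχ_apply, QuotientGroup.mk'_apply]
        exact QuotientGroup.lift_mk _ hker g
      have hS : ellPowersY D 2 ≤ Ψ.ker := by
        rw [ellPowersY, Subgroup.closure_le]
        rintro _ ⟨e, ⟨w, -, rfl⟩, rfl⟩
        change toEll D w ^ ((2 : ℕ+) : ℕ) ∈ Ψ.ker
        rw [MonoidHom.mem_ker, map_pow, h2, mulZMod_two_sq]
      have h1 : Ψ (toEll D y₁ ^ k) = 1 := (MonoidHom.mem_ker).mp (hS hk)
      rw [map_pow, hΨ, hΨ₀, SemidirectProduct.left_inl, hlev_bG] at h1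
      have h1' := congrArg Multiplicative.toAdd h1
      rw [toAdd_pow, toAdd_ofAdd, toAdd_one, nsmul_eq_mul, mul_one] at h1'
      exact (ZMod.natCast_eq_zero_iff k 2).mp h1'
    · rintro ⟨j, rfl⟩
      rw [pow_mul', ← map_pow (toEll D)]
      exact Subgroup.subset_closure ⟨toEll D (y₁ ^ j), ⟨y₁ ^ j, D.DtpY.pow_mem hy₁ j, rfl⟩, rfl⟩
  · -- (b) Tate twist: `k` is odd; conjugation multiplies `ê_b` by `χ(σ)`, invisible mod `2`
    intro g k hk y hy
    have hk' : (-1 : PadicAlgCl p) ^ k = -1 := by rw [← hk, map_neg, map_one]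
    have hkodd := odd_of_neg_one_pow_eq' p hk'
    obtain ⟨hyr, -, hyx⟩ := right_eq_one_and_eHat_eq_one_of_mem_dtpY p hy
    rw [← map_pow (toEll D), ← map_inv (toEll D), ← map_mul (toEll D), eq_inl_of_right_eq_one hyr,
      conj_inl_eq,
      ← map_pow (SemidirectProduct.inl : Gfp →* PiTpχ p), ← map_inv (SemidirectProduct.inl : Gfp →* PiTpχ p),
      ← map_mul (SemidirectProduct.inl : Gfp →* PiTpχ p)]
    refine toEll_inl_mem_ellPowersY_two p ?_ ?_
    · simp only [map_mul, map_inv, map_pow, actχ_apply, gfpFst_twistGfp, eHat_twist, hyx, one_pow, inv_one,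
        mul_one, mul_inv_cancel]
    · show lev (eHatB (gfpFst (g.left * actχ p g.right y.left * g.left⁻¹ * (y.left ^ k)⁻¹))) = 1
      simp only [map_mul, map_inv, map_pow, actχ_apply, gfpFst_twistGfp, eHatB_twist, hlev_aut]
      rw [mulZMod_two_inv, mulZMod_two_inv, mul_right_comm _ _ (lev (eHatB (gfpFst g.left))), ← sq,
        mulZMod_two_sq, one_mul, ← pow_succ']
      exact mulZMod_two_pow_even _ (hkodd.add_odd odd_one)
  · -- (c) Kummer class of `q_X = p²`: `m` is even; the `a`-axis is untwisted, so `[g, z]` is a `Γ`-commutator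
    intro g m hm
    have hm1 : (-1 : PadicAlgCl p) ^ m = 1 := by
      have h' : (-1 : PadicAlgCl p) ^ m * (p : ℕ) = 1 * (p : ℕ) := by
        rw [one_mul, ← hm]; exact map_natCast _ p
      exact mul_right_cancel₀ hp0 h'
    have hmev := even_of_neg_one_pow_eq_one' p hm1
    change toEll D (g * SemidirectProduct.inl aG * g⁻¹ * (SemidirectProduct.inl aG)⁻¹) *
        (toEll D (SemidirectProduct.inl bG) ^ m)⁻¹ ∈ _
    rw [← map_pow (toEll D), ← map_inv (toEll D), ← map_mul (toEll D), conj_inl_eq, actχ_eta_a',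
      ← map_inv (SemidirectProduct.inl : Gfp →* PiTpχ p), ← map_mul (SemidirectProduct.inl : Gfp →* PiTpχ p),
      ← map_pow (SemidirectProduct.inl : Gfp →* PiTpχ p), ← map_inv (SemidirectProduct.inl : Gfp →* PiTpχ p),
      ← map_mul (SemidirectProduct.inl : Gfp →* PiTpχ p)]
    refine toEll_inl_mem_ellPowersY_two p ?_ ?_
    · simp only [map_mul, map_inv, map_pow, haG_x, haG_x', hbG_x, one_pow, inv_one, mul_one]
      rw [zh_mul_comm (eHat (gfpFst g.left)) (iotaZ (Multiplicative.ofAdd 1))]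
      group
    · show lev (eHatB (gfpFst (g.left * aG * g.left⁻¹ * aG⁻¹ * (bG ^ m)⁻¹))) = 1
      simp only [map_mul, map_inv, map_pow, haG_y, hlev_bG, inv_one, mul_one, mul_inv_cancel, one_mul]
      rw [inv_eq_one]
      exact mulZMod_two_pow_even _ hmev

/-- **«`G_{K_2} = Ker(G_K ↷ (Δ^tp_X)^ell / 2·(Δ^tp_Y)^ell)`» HOLDS at the χ-twisted model**: the `N = 2` instance
of abc-iut-L6-d5's `Thm16Sub.GKNIsKernelOfAction` at `ThetaSetting.modelχ p`, by this seat's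
`gknIsKernelOfAction_of_tate` (p420414) from `modelχ_tate2`. [cite: MochizukiEtTh2009, §1 p.13] -/
theorem modelχ_gknIsKernelOfAction_two : GKNIsKernelOfAction (ThetaSetting.modelχ p) 2 := by
  obtain ⟨y₁, z, ζ, r, hy₁, hz, hzZ, hζ, hr, -, hord, htw, hkum⟩ := modelχ_tate2 p
  exact gknIsKernelOfAction_of_tate (ThetaSetting.modelχ p) 2 hy₁ hz hzZ hζ hr hord htw hkum

end Model

end Literature.AnabelianGeometry.EtaleTheta.SettingModel

end
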